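import Summits.QuantumFields.YangMills.Theorems.UnitScaleTiltProp8ChartDoubleBarDefs
import Summits.QuantumFields.YangMills.Theorems.UnitScaleTiltProp8ChartHInvGeometry
import HarnessLib

/-!
# Route `UnitScaleTilt`, crux K1 «MinimiserStabilityRegPr» (stmt-QuantumFields-19200), stub V2′ `stub_halvingStep` — pillar P3 RE-BASED (★★OWNER RULING g26-№6∕№7, (R1)):
# **THE READ SET OF PRINT'S DOUBLE-BAR CHART** — `vframeU`, `dbarAvgU`, `dbarIterU` and `chartLogFlat` (✓ `…ChartDoubleBarDefs`) are TWO-BLOCK LOCAL, with the SAME read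
# set as the retired single-bar chart ((S4) «ChartLocality♭»; the twin of ✓ `…ChartLocality` §1–§2)

Cell `ym3-torus` (HUMAN RULING D-0037: YM₃ on the torus is ladder rung R3, not the Clay problem), width seat `ym-ust-19200-w8` gen 0 ((S4) assist, ★★OWNER RULING
g26-№6).  `--supports stmt-QuantumFields-19200 --as helper`; def-free, 0 sorry, standard axioms.

WHY.  Under the re-base (R1) the chart of record is `chartLogFlat η D A (j, c) = −i·log U̿^{(j)}(e^{iηA})(c)` with [Balaban1985Averaging] (89) `U̿(c) = v(c₋)⁻¹·Ū(c)·v(c₊)`,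
frames `v(y) = exp[mean log]` of the centre staircases of `B(y)`, recomputed at every level ((F-b), RULING g26-№7).  The (X2-C′) column letter of `…ChartRemainderColumnLetter`
(§2 derivative locality, §5) and the locality half of the P3a engine re-read ((S3)) need, exactly as for the single bar, that an index `(j, c)` reads `A` only on the fine bonds
under the two `j`-blocks of `c`.  Print: *«these operations have the same locality properties as the averages Ū^k»* ([Balaban1985Averaging] p. 31, after (91)); the centre
staircases of (0.3) stay in their block (✓ `ChartHInv.blockOf_of_mem_walk_stairWord`), so the frames add nothing to the read set.

WHAT IS PROVED (sorry-free; no definition; every `P : Params`, complete normed ℂ-algebra `𝔸`):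
* §1 **`vframeU_congr`** (`v(y)` reads only the bonds with both end-points in `B(y)`), **`dbarAvgU_congr₂`** (`U̿(c)` reads only the bonds with both end-points in
  `B(c₋) ∪ B(c₊)` — ✓`emlAvgU_congr₂` + the two frames);
* §2 **`dbarIterU_congr_of_agree`** (the `j`-fold double-bar average at `c` reads only the fine bonds `b` with `Bʲ(b₋), Bʲ(b₊) ∈ {c₋, c₊}`), ★ **`chartLogFlat_congr`** (the
  read set of an index of the ♭ chart — the twin of `Prop8Chart.chartLog_congr`, same hypothesis text), `chartLogFlat_add_of_vanish_on_read`.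
HONEST SCOPE.  Lattice bookkeeping over the landed definitions; no estimate, nothing of (44)∕(55)∕(72)∕(73); NOT a claim about the stub, the crux, the rung or the mass gap.

References: T. Bałaban, CMP **98** (1985) 17–51 [Balaban1985Averaging] (89) p.31 (+ the locality sentence after (91)), (110) p.34, (127) p.36, (150) p.40; CMP **102** (1985)
277–309 [Balaban1985Variational] (20) p.281, (156) p.302; CMP **109** (1987) 249–301 [Balaban1987RG1] (0.3)–(0.4) pp.252–253.
-/

set_option autoImplicit false

noncomputable section

namespace Summit.QuantumFields.YangMills.Theorems.Prop8ChartDoubleBar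

open Literature.MathematicalPhysics.QuantumFieldTheory.Balaban1983to89
open T4Continuum BlockAveraging ExpMeanLog MatrixLog
open B10Eq27TorusAxialLog (holT)
open B6SectADomainsV1 (Domains)
open B6SectAOperatorsV1 (BondIdx)
open B5Eq118OneStroke (iterBlockOf iterBlockOf_succ iterBlockOf_zero)
open Summit.QuantumFields.YangMills.Theorems.Prop8Chart (expCfg coe_expCfg emlAvgU holT_congr emlAvgU_congr₂)
open Summit.QuantumFields.YangMills.Theorems.ChartHInv (blockOf_of_mem_walk_stairWord)

variable {P : Params} {𝔸 : Type*} [NormedRing 𝔸] [NormedAlgebra ℂ 𝔸] [CompleteSpace 𝔸]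

/-! ## §1 The block frame and the double-bar average are two-block local -/

section TwoBlock

variable {j : ℕ}

/-- **THE BLOCK FRAME `v(y)` READS ONLY THE BONDS INSIDE `B(y)`**: the centre staircases of (0.3) stay in their block (`ChartHInv.blockOf_of_mem_walk_stairWord`), so two
fields agreeing on the bonds with both end-points in `B(y)` have the same frame. [cite: Balaban1985Averaging, (110) p.34; Balaban1987RG1, (0.3) p.252] -/
theorem vframeU_congr (hj : j + 1 ≤ P.m + P.K) {U U' : GaugeField P j 𝔸ˣ} (y : Site P (j + 1))
    (hUU' : ∀ b : PBond P j, blockOf b.src = y → blockOf b.tgt = y → U b = U' b) : vframeU U y = vframeU U' y := by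
  apply Units.ext
  rw [coe_vframeU, coe_vframeU]
  have h : (fun i : Idx P => ((holT U (emb y) (stairWord i.2.1 (off i.1)) : 𝔸ˣ) : 𝔸)) =
      fun i : Idx P => ((holT U' (emb y) (stairWord i.2.1 (off i.1)) : 𝔸ˣ) : 𝔸) := by
    funext i
    rw [holT_congr (stairWord i.2.1 (off i.1)) (emb y) fun s hs =>
      hUU' s.bond (blockOf_of_mem_walk_stairWord hj y i.2.1 i.1 hs).1 (blockOf_of_mem_walk_stairWord hj y i.2.1 i.1 hs).2]
  rw [h]

/-- **THE DOUBLE-BAR AVERAGE IS TWO-BLOCK LOCAL** — the SAME read set as the single bar: `U̿(c) = v(c₋)⁻¹·Ū(c)·v(c₊)` depends only on the bond variables with both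
end-points in `B(c₋) ∪ B(c₊)` (✓`emlAvgU_congr₂` and the two frames). [cite: Balaban1985Averaging, (89) p.31, (110) p.34; Balaban1987RG1, (0.4) p.253] -/
theorem dbarAvgU_congr₂ (hj : j + 1 ≤ P.m + P.K) {U U' : GaugeField P j 𝔸ˣ} (c : PBond P (j + 1))
    (hUU' : ∀ b : PBond P j, (blockOf b.src = c.src ∨ blockOf b.src = c.tgt) → (blockOf b.tgt = c.src ∨ blockOf b.tgt = c.tgt) → U b = U' b) :
    dbarAvgU U c = dbarAvgU U' c := by
  rw [dbarAvgU_apply, dbarAvgU_apply, emlAvgU_congr₂ hj c hUU',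
    vframeU_congr hj c.src (fun b h1 h2 => hUU' b (Or.inl h1) (Or.inl h2)),
    vframeU_congr hj c.tgt (fun b h1 h2 => hUU' b (Or.inr h1) (Or.inr h2))]

end TwoBlock

/-! ## §2 The read set of the iterated double-bar average and of the ♭ chart -/

section ReadSet

/-- **THE `j`-FOLD DOUBLE-BAR AVERAGE AT `c` READS ONLY THE FINE BONDS UNDER THE TWO `j`-BLOCKS OF `c`** (`Bʲ(b₋), Bʲ(b₊) ∈ {c₋, c₊}`; induction over the levels with
§1 — the frames are recomputed from the previous double-bar level, which has the same read set). [cite: Balaban1985Averaging, (127) p.36, (150) p.40; Balaban1987RG1, (0.4) p.253] -/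
theorem dbarIterU_congr_of_agree :
    ∀ (j : ℕ), j ≤ P.m + P.K → ∀ {U U' : GaugeField P 0 𝔸ˣ} (c : PBond P j),
      (∀ b : PBond P 0, (iterBlockOf j b.src = c.src ∨ iterBlockOf j b.src = c.tgt) →
        (iterBlockOf j b.tgt = c.src ∨ iterBlockOf j b.tgt = c.tgt) → U b = U' b) →
      dbarIterU j U c = dbarIterU j U' c
  | 0, _, U, U', c, h => by
    rw [dbarIterU_zero, dbarIterU_zero]
    exact h c (Or.inl rfl) (Or.inr rfl)
  | j + 1, hj, U, U', c, h => by
    rw [dbarIterU_succ, dbarIterU_succ]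
    refine dbarAvgU_congr₂ hj c fun e hes het => dbarIterU_congr_of_agree j (Nat.le_of_succ_le hj) e fun b hbs hbt => h b ?_ ?_
    · rw [iterBlockOf_succ]
      rcases hbs with h1 | h1 <;> rw [h1]
      · exact hes
      · exact het
    · rw [iterBlockOf_succ]
      rcases hbt with h1 | h1 <;> rw [h1]
      · exact hes
      · exact het

/-- **THE READ SET OF AN INDEX OF THE ♭ CHART**: `chartLogFlat η D A (j, c)` depends only on `A` on the fine bonds under the two `j`-blocks of `c` — the twin of
✓`Prop8Chart.chartLog_congr`, so the derivative-locality lemmas of `…ChartRemainderColumnLetter` §2 re-read verbatim for the chart of record.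
[cite: Balaban1985Variational, (20) p.281, (156) p.302; Balaban1985Averaging, (89) p.31, (127) p.36] -/
theorem chartLogFlat_congr (η : ℝ) (D : Domains P) {A A' : PBond P 0 → 𝔸} (idx : BondIdx D)
    (h : ∀ b : PBond P 0, (iterBlockOf (idx.1.1 : ℕ) b.src = idx.1.2.src ∨ iterBlockOf (idx.1.1 : ℕ) b.src = idx.1.2.tgt) →
      (iterBlockOf (idx.1.1 : ℕ) b.tgt = idx.1.2.src ∨ iterBlockOf (idx.1.1 : ℕ) b.tgt = idx.1.2.tgt) → A b = A' b) :
    chartLogFlat η D A idx = chartLogFlat η D A' idx := by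
  have hj : (idx.1.1 : ℕ) ≤ P.m + P.K := (Nat.lt_succ_iff.mp idx.1.1.isLt).trans D.hk
  rw [chartLogFlat_apply, chartLogFlat_apply, dbarIterU_congr_of_agree (idx.1.1 : ℕ) hj idx.1.2 fun b hbs hbt => ?_]
  apply Units.ext
  rw [coe_expCfg, coe_expCfg, h b hbs hbt]

/-- **EQUIVALENTLY: CHANGING `A` ON A BOND NOT READ BY THE INDEX DOES NOT CHANGE THE ♭ CHART THERE** (`A + X` with `X` vanishing on the read set).
[cite: Balaban1985Variational, (156) p.302; Balaban1985Averaging, (127) p.36] -/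
theorem chartLogFlat_add_of_vanish_on_read (η : ℝ) (D : Domains P) (A X : PBond P 0 → 𝔸) (idx : BondIdx D)
    (hX : ∀ b : PBond P 0, (iterBlockOf (idx.1.1 : ℕ) b.src = idx.1.2.src ∨ iterBlockOf (idx.1.1 : ℕ) b.src = idx.1.2.tgt) →
      (iterBlockOf (idx.1.1 : ℕ) b.tgt = idx.1.2.src ∨ iterBlockOf (idx.1.1 : ℕ) b.tgt = idx.1.2.tgt) → X b = 0) :
    chartLogFlat η D (A + X) idx = chartLogFlat η D A idx :=
  chartLogFlat_congr η D idx fun b hbs hbt => by rw [Pi.add_apply, hX b hbs hbt, add_zero]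

end ReadSet

end Summit.QuantumFields.YangMills.Theorems.Prop8ChartDoubleBar

end
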